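import Mathlib.Algebra.MvPolynomial.Funext
import Mathlib.LinearAlgebra.Matrix.NonsingularInverse
import Mathlib.LinearAlgebra.Matrix.GeneralLinearGroup.Defs
import Literature.LinearAlgebra.BaseChange.RationalRelations
import HarnessLib

/-!
# Similarity of matrices descends from an extension to an infinite base field

Let `F` be an infinite field, `K` a non-trivial commutative `F`-algebra (for instance an
extension field of `F`) and `A, B ∈ M_n(F)`. If `A` and `B` become conjugate under `GL_n(K)`,
they are already conjugate under `GL_n(F)` (`exists_isUnit_and_mul_eq_mul_of_map`; `GL_n` /
`IsConj` form `isConj_of_isConj_map`).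

## The proof (elementary; no rational canonical form)

1. `exists_eq_sum_smul_map_of_mul_map_eq`: the `K`-solutions `Y` of the linear system
   `Y A = B Y`, whose coefficients lie in `F`, are `K`-linear combinations `Y = ∑ₗ cₗ Xₗ` of
   `F`-solutions `Xₗ A = B Xₗ` — the solution space is defined over `F`
   (`Literature.LinearAlgebra.BaseChange.exists_algebraMap_coords`; Bourbaki, *Algebra II*,
   Ch. II §8). This step needs neither `F` infinite nor `K` non-trivial.
2. `D(t) = det (∑ₗ tₗ Xₗ) ∈ F[t₁, …, t_t]` is a polynomial whose value at `c ∈ Kᵗ` is `det Y`, a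
   unit of `K`; so `D ≠ 0`, and a non-zero polynomial over an infinite field has a non-zero
   value `D(a)`, `a ∈ Fᵗ` (`MvPolynomial.funext`); `X = ∑ₗ aₗ Xₗ` is the required `F`-conjugator.

Over an arbitrary field the statement is still true (the invariant factors of `A` do not
change under field extension: Hungerford, *Algebra*, Ch. VII, §4, Exercises 6–7 after Prop. 4.9),
but that proof needs the uniqueness half of the structure theorem over `F[X]` (Hungerford,
Cor. VII.4.7 (ii)), which Mathlib lacks; only the infinite case — the one used in characteristic
zero, e.g. for Arthur–Clozel, Ch. 1, Lemma 1.1 (i)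
(`Literature.NumberTheory.Automorphic.ArthurClozelNormMap`) — is proved here.

## References
* T. W. Hungerford, *Algebra*, GTM 73, Springer (1974), Ch. VII, §4, Cor. 4.7, Prop. 4.9,
  Exercises 6–7.
* N. Bourbaki, *Algebra II*, Ch. II §8 (rational structures on vector spaces).
-/

namespace Literature.LinearAlgebra.Matrix

open MvPolynomial

section Solutions

variable {F K : Type*} [Field F] [CommRing K] [Algebra F K] {n : Type*} [Fintype n]
  [DecidableEq n]

/-- **The intertwiners over `K` are spanned by the intertwiners over `F`.** If `A, B ∈ M_n(F)`
and `Y ∈ M_n(K)` satisfies `Y A = B Y` (with `A, B` mapped to `K`), then `Y = ∑ₗ cₗ • Xₗ` for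
finitely many `Xₗ ∈ M_n(F)` with `Xₗ A = B Xₗ` and scalars `cₗ ∈ K`: the solution space of a
linear system with coefficients in `F` is defined over `F` (Bourbaki, *Algebra II*, Ch. II §8;
here from `Literature.LinearAlgebra.BaseChange.exists_algebraMap_coords` applied to the family
of entries of `Y`). [folklore] -/
theorem exists_eq_sum_smul_map_of_mul_map_eq (A B : Matrix n n F) (Y : Matrix n n K)
    (hY : Y * A.map (algebraMap F K) = B.map (algebraMap F K) * Y) :
    ∃ (t : ℕ) (c : Fin t → K) (X : Fin t → Matrix n n F),
      Y = ∑ l, c l • (X l).map (algebraMap F K) ∧ ∀ l, X l * A = B * X l := by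
  classical
  obtain ⟨t, c, q, hq, hrel⟩ :=
    BaseChange.exists_algebraMap_coords F (K := K) (fun ij : n × n => Y ij.1 ij.2)
  refine ⟨t, c, fun l => Matrix.of fun i j => q (i, j) l, ?_, fun l => ?_⟩
  · ext i j
    rw [hq (i, j), Matrix.sum_apply]
    refine Finset.sum_congr rfl fun l _ => ?_
    simp only [Matrix.smul_apply, Matrix.map_apply, Matrix.of_apply, smul_eq_mul]
    exact mul_comm _ _
  · ext i j
    -- the `(i, j)` entry of `Y A = B Y` is an `F`-linear relation among the entries of `Y`
    have hij := congr_fun (congr_fun hY i) j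
    simp only [Matrix.mul_apply, Matrix.map_apply] at hij
    let r : n × n → F := fun pq =>
      (if pq.1 = i then A pq.2 j else 0) - (if pq.2 = j then B i pq.1 else 0)
    have h1 : ∑ pq : n × n, algebraMap F K (if pq.1 = i then A pq.2 j else 0) * Y pq.1 pq.2 =
        ∑ k, Y i k * algebraMap F K (A k j) := by
      rw [Fintype.sum_prod_type]
      simp only [apply_ite (algebraMap F K), map_zero, ite_mul, zero_mul, Finset.sum_ite_irrel,
        Finset.sum_const_zero, Finset.sum_ite_eq', Finset.mem_univ, if_true]
      exact Finset.sum_congr rfl fun k _ => mul_comm _ _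
    have h2 : ∑ pq : n × n, algebraMap F K (if pq.2 = j then B i pq.1 else 0) * Y pq.1 pq.2 =
        ∑ k, algebraMap F K (B i k) * Y k j := by
      rw [Fintype.sum_prod_type]
      simp only [apply_ite (algebraMap F K), map_zero, ite_mul, zero_mul, Finset.sum_ite_eq',
        Finset.mem_univ, if_true]
    have hr : ∑ pq : n × n, algebraMap F K (r pq) * Y pq.1 pq.2 = 0 := by
      simp only [r, map_sub, sub_mul, Finset.sum_sub_distrib, h1, h2]
      rw [hij, sub_self]
    have key := hrel r hr l
    have k1 : ∑ pq : n × n, (if pq.1 = i then A pq.2 j else 0) * q pq l =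
        ∑ k, q (i, k) l * A k j := by
      rw [Fintype.sum_prod_type]
      simp only [ite_mul, zero_mul, Finset.sum_ite_irrel, Finset.sum_const_zero,
        Finset.sum_ite_eq', Finset.mem_univ, if_true]
      exact Finset.sum_congr rfl fun k _ => mul_comm _ _
    have k2 : ∑ pq : n × n, (if pq.2 = j then B i pq.1 else 0) * q pq l =
        ∑ k, B i k * q (k, j) l := by
      rw [Fintype.sum_prod_type]
      simp only [ite_mul, zero_mul, Finset.sum_ite_eq', Finset.mem_univ, if_true]
    simp only [r, sub_mul, Finset.sum_sub_distrib, k1, k2, sub_eq_zero] at key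
    rw [Matrix.mul_apply, Matrix.mul_apply]
    simpa only [Matrix.of_apply] using key

end Solutions

section Descent

/-- Evaluating the generic combination `∑ₗ tₗ Xₗ` (indeterminate coefficients `tₗ`) along a
ring homomorphism `f` out of the polynomial ring gives `∑ₗ f(tₗ) Xₗ`. [folklore] -/
private theorem mapMatrix_sum_X_smul {F : Type*} [Field F] {n : Type*} [Fintype n]
    [DecidableEq n] {t : ℕ} (X : Fin t → Matrix n n F) {S : Type*} [CommRing S]
    (f : MvPolynomial (Fin t) F →+* S) :
    f.mapMatrix (∑ l, (MvPolynomial.X l : MvPolynomial (Fin t) F) • (X l).map MvPolynomial.C) =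
      ∑ l, f (MvPolynomial.X l) • (X l).map (f.comp MvPolynomial.C) := by
  ext i j
  simp [Matrix.sum_apply, map_sum]

variable {F K : Type*} [Field F] [Infinite F] [CommRing K] [Nontrivial K] [Algebra F K]
  {n : Type*} [Fintype n] [DecidableEq n]

/-- **Similarity descends to an infinite base field.** Let `F` be an infinite field, `K` a
non-trivial commutative `F`-algebra and `A, B ∈ M_n(F)`. If an invertible `Y ∈ M_n(K)` satisfies
`Y A = B Y`, then an invertible `X ∈ M_n(F)` satisfies `X A = B X`. Proof: write
`Y = ∑ₗ cₗ Xₗ` with `F`-intertwiners `Xₗ` (`exists_eq_sum_smul_map_of_mul_map_eq`); the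
polynomial `det (∑ₗ tₗ Xₗ)` over `F` takes the unit value `det Y` at `c`, so it is non-zero and,
`F` being infinite, has a non-zero value at some `a ∈ Fᵗ` (`MvPolynomial.funext`); take
`X = ∑ₗ aₗ Xₗ` (Hungerford, *Algebra*, Ch. VII, §4, Exercise 7, there for arbitrary `F` via the
invariant factors). [folklore] -/
theorem exists_isUnit_and_mul_eq_mul_of_map (A B : Matrix n n F) (Y : Matrix n n K)
    (hYu : IsUnit Y) (hY : Y * A.map (algebraMap F K) = B.map (algebraMap F K) * Y) :
    ∃ X : Matrix n n F, IsUnit X ∧ X * A = B * X := by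
  classical
  obtain ⟨t, c, X, rfl, hX⟩ := exists_eq_sum_smul_map_of_mul_map_eq A B Y hY
  -- the generic linear combination of the `Xₗ`, with indeterminate coefficients
  let M : Matrix n n (MvPolynomial (Fin t) F) :=
    ∑ l, (MvPolynomial.X l : MvPolynomial (Fin t) F) • (X l).map MvPolynomial.C
  have hdetK : MvPolynomial.eval₂Hom (algebraMap F K) c M.det =
      (∑ l, c l • (X l).map (algebraMap F K)).det := by
    rw [RingHom.map_det, mapMatrix_sum_X_smul]
    congr 1
    refine Finset.sum_congr rfl fun l _ => ?_
    rw [MvPolynomial.coe_eval₂Hom, MvPolynomial.eval₂_X]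
    congr 1
    ext i j
    simp
  have hP : M.det ≠ 0 := by
    intro h0
    have hu : IsUnit (∑ l, c l • (X l).map (algebraMap F K)).det :=
      (Matrix.isUnit_iff_isUnit_det _).mp hYu
    rw [← hdetK, h0, map_zero] at hu
    exact not_isUnit_zero hu
  obtain ⟨a, ha⟩ : ∃ a : Fin t → F, MvPolynomial.eval a M.det ≠ 0 := by
    by_contra! hall
    exact hP (MvPolynomial.funext fun x => by rw [hall x, map_zero])
  have hdetF : MvPolynomial.eval a M.det = (∑ l, a l • X l).det := by
    rw [RingHom.map_det, mapMatrix_sum_X_smul]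
    congr 1
    refine Finset.sum_congr rfl fun l _ => ?_
    rw [MvPolynomial.eval_X]
    congr 1
    ext i j
    simp
  refine ⟨∑ l, a l • X l, ?_, ?_⟩
  · rw [Matrix.isUnit_iff_isUnit_det, isUnit_iff_ne_zero, ← hdetF]
    exact ha
  · simp only [Finset.sum_mul, Finset.mul_sum, smul_mul_assoc, mul_smul_comm, hX]

/-- **Conjugacy in `GL_n` descends to an infinite base field**: if `g, h ∈ GL_n(F)` become
conjugate in `GL_n(K)` (`F` an infinite field, `K` a non-trivial commutative `F`-algebra), they
are conjugate in `GL_n(F)` (`exists_isUnit_and_mul_eq_mul_of_map`; Hungerford, *Algebra*,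
Ch. VII, §4, Exercise 7). [folklore] -/
theorem isConj_of_isConj_map (g h : GL n F)
    (hc : IsConj (Matrix.GeneralLinearGroup.map (algebraMap F K) g)
      (Matrix.GeneralLinearGroup.map (algebraMap F K) h)) :
    IsConj g h := by
  rw [isConj_iff] at hc ⊢
  obtain ⟨c, hc⟩ := hc
  rw [mul_inv_eq_iff_eq_mul] at hc
  have hc' : (c : Matrix n n K) * (g : Matrix n n F).map (algebraMap F K) =
      (h : Matrix n n F).map (algebraMap F K) * c := by
    have := congrArg (fun x : GL n K => (x : Matrix n n K)) hc
    simpa [Units.val_mul] using this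
  obtain ⟨X, hXu, hX⟩ :=
    exists_isUnit_and_mul_eq_mul_of_map (K := K) (g : Matrix n n F) h c c.isUnit hc'
  obtain ⟨u, rfl⟩ := hXu
  refine ⟨u, ?_⟩
  rw [mul_inv_eq_iff_eq_mul]
  exact Units.val_injective (by simpa [Units.val_mul] using hX)

end Descent

end Literature.LinearAlgebra.Matrix
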